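import Literature.NumberTheory.EllipticCurves.HeegnerPointsKolyvaginPairingCM
import HarnessLib

/-!
# Joint evaluations for a PAIR of curves (linear disjointness in subgroup form)

Third file of the `p = 2` / CM algebra for the Čebotarev leaf (after `HeegnerPointsKolyvaginPairingCM`
— Props. 9.1/9.3 for an action through commuting operators — and
`HeegnerPointsKolyvaginPairingCMConj`). McCallum's Cor. 3.2 / Gross's §10 choose ONE Kolyvagin
prime serving several classes of ONE curve; the coupled descent of the cell memo MEMO-bsd-cm-two
§57.4 (Steps 7–8, leaf (L3) of `Summits/…/SylvesterTwoHeegnerIndexCoupledDescentAtTwo.lean`) needs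
one prime serving classes of TWO curves `A`, `B` at once, which rests on the LINEAR DISJOINTNESS of
`L_{A,S}/L_A` and `L_{B,S′}/L_B` over `K` (memo Step 7: *"`L_{A,S_A} ⊃ L_A` and `L_B(½Y) ⊃ L_B`
are linearly disjoint over `K` … the only Galois cubic subfield … is `L_A ≠ L_B`"*). This file
proves the resulting JOINT choice of the Galois element in subgroup form, for any field tower
`K/k`, any two Weierstrass curves over `k` and any prime level `p` (everything **proved**; no
named fact):

* (private) `h1Eval_pow_of_mem` — `[x, ρ^e] = e • [x, ρ]` on `Γ_{K(E[p])}` (any field).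
* `exists_h1Eval_eq_of_comm_of_pow_mem` — **joint surjectivity from the smaller group
  `Γ_{K(A[p])} ∩ Γ_{K(B[p])}`** for classes of `A`, when `Γ_K / Γ_{K(B[p])}` has an exponent `e`
  acting as the identity on `A[p]` (`ρ^e ∈ Γ_{K(B[p])}` for all `ρ`, `e • P = P` on `A[p]`; for
  `ℤ[ω]`-CM at `p = 2`: `e = 3`): the values `([x_i, ρ])_i`, `ρ ∈ Γ_{K(A[p])} ∩ Γ_{K(B[p])}`,
  exhaust `A[p]^r` for `(ℤ/p)[w]`-independent `x_i` (Prop. 9.3 commuting form for the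
  `Γ_K`-stable subgroup of these values; independence of its functionals from `[s, ρ^e] = [s, ρ]`).
* `exists_h1Eval_eq_and_eq_zero_of_comm` — **prescribed `A`-values, zero `B`-values**: if moreover
  some `z ∈ Γ_{K(B[p])}` has `z - 1` surjective on `A[p]` (disjointness: the characters of `Γ_K`
  on `A[2]` and `B[2]` are independent), then for every target there is
  `c ∈ Γ_{K(A[p])} ∩ Γ_{K(B[p])}` with `[x_i, c]_A` prescribed and `[y_j, c]_B = 0` for any classes
  `y_j` of `B` — the commutator `c = zρz⁻¹ρ⁻¹` has `A`-values `(z-1)[x, ρ]` and `B`-values `0`.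
* `exists_h1Eval_eq_pair_of_comm` — **THE JOINT ELEMENT**: under the hypotheses for both curves,
  every pair of targets `(e^A_i)`, `(e^B_j)` is `([x_i, ρ]_A)_i`, `([y_j, ρ]_B)_j` for ONE
  `ρ ∈ Γ_{K(A[p])} ∩ Γ_{K(B[p])}` (product of the two one-sided elements).

With `HeegnerPointsKolyvaginPairingCMConj` (the `(1+τ)`-bookkeeping for `(τρm)²`, applied to this
joint `ρ`) this is «THE ρ» consumed by the pair version of the tree's
`exists_kolyvaginPrime_gt_of_galoisElement` (bsd-cm-k7t-c3x). Not here: that density argument.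

## References

* B. H. Gross, *Kolyvagin's work on modular elliptic curves*, LMS LN 153 (1991), §9 (pairing,
  Props. 9.1, 9.3). [GrossLMS1991]
* W. G. McCallum, *Kolyvagin's work on Shafarevich–Tate groups*, ibid., §3 (2). [McCallumLMS1991]
* Cell memo MEMO-bsd-cm-two §57.4, Step 7 (disjointness) and Step 8 (b).
-/

noncomputable section

open scoped Classical
open WeierstrassCurve
open Literature.NumberTheory.GaloisRepresentations

universe u v

namespace Literature.NumberTheory.EllipticCurves

section Pow

variable {K : Type u} [Field K] (W : WeierstrassCurve K) (n : ℤ)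

/-- `[x, ρ^e] = e • [x, ρ]` for `ρ ∈ Γ_{K(E[n])}`: `ρ ↦ [x, ρ]` is a homomorphism on
`Γ_{K(E[n])}` (Gross 1991, Prop. 9.1; tree `h1Eval_mul`). A private copy, for any field `K`, of
the tree's `h1Eval_pow` (`HeegnerPointsKolyvaginLocalCriterion`, stated over number fields).
[cite: GrossLMS1991, Prop. 9.1] -/
private theorem h1Eval_pow_of_mem (x : galH1Torsion W n) {ρ : Field.absoluteGaloisGroup K}
    (hρ : ρ ∈ torsionFixing W n) (e : ℕ) : h1Eval W n x (ρ ^ e) = e • h1Eval W n x ρ := by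
  induction e with
  | zero => rw [pow_zero, h1Eval_one, zero_smul]
  | succ e ih => rw [pow_succ', h1Eval_mul W n x hρ, ih, add_comm, succ_nsmul]

end Pow

section Pair

variable {K : Type u} [Field K] (A B : WeierstrassCurve K) {p : ℕ}

/-- **Joint surjectivity from `Γ_{K(A[p])} ∩ Γ_{K(B[p])}` (Gross Prop. 9.3, commuting form,
relative to a second curve).** Hypotheses for `A` as in `exists_h1Eval_eq_of_comm` (simple
`A[p]`, commutant `{a + b w}`, commuting action with some `z - 1` invertible, `wH` over `w`,
`(ℤ/p)[w]`-independent classes `x_i`), plus: an exponent `e` with `ρ^e ∈ Γ_{K(B[p])}` for every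
`ρ ∈ Γ_K` and `e • P = P` on `A[p]` (for `B` with CM by `ℤ[ω]` over `K ∋ ω` and `p = 2`:
`Gal(K(B[2])/K)` has exponent `3` and `3 = 1` on `A[2]`). Then every `(e_i) ∈ A[p]^r` is
`([x_i, ρ])_i` for some `ρ ∈ Γ_{K(A[p])} ∩ Γ_{K(B[p])}`. Proof:
`KolyvaginPairing.eq_top_of_stable_of_indep_of_comm` for the `Γ_K`-stable subgroup of joint values
over the intersection (both subgroups are normal); a relation among its functionals gives a class
`s` with `[s, ρ] = 0` on the intersection, hence `[s, ρ] = [s, ρ^e] = 0` on all of `Γ_{K(A[p])}`,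
so `s = 0` by `eq_zero_of_h1Eval_eq_zero_of_comm`. [cite: GrossLMS1991, Prop. 9.3] -/
theorem exists_h1Eval_eq_of_comm_of_pow_mem (hp : p.Prime)
    (hS : ∀ H : AddSubgroup (geomTorsion A p),
      (∀ g : Field.absoluteGaloisGroup K, ∀ t ∈ H, g • t ∈ H) → H = ⊥ ∨ H = ⊤)
    (w : geomTorsion A p →+ geomTorsion A p)
    (hC : ∀ f : geomTorsion A p →+ geomTorsion A p,
      (∀ (g : Field.absoluteGaloisGroup K) (t : geomTorsion A p), f (g • t) = g • f t) →
        ∃ a b : ℤ, ∀ t, f t = a • t + b • w t)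
    (hcomm : ∀ (g h : Field.absoluteGaloisGroup K) (P : geomTorsion A p), g • h • P = h • g • P)
    {z : Field.absoluteGaloisGroup K} (ι : geomTorsion A p →+ geomTorsion A p)
    (hι : ∀ P, ι (z • P - P) = P)
    (hιg : ∀ (g : Field.absoluteGaloisGroup K) (P : geomTorsion A p), ι (g • P) = g • ι P)
    (wH : galH1Torsion A p →+ galH1Torsion A p)
    (hwH : ∀ x, ∀ ρ ∈ torsionFixing A p, h1Eval A p (wH x) ρ = w (h1Eval A p x ρ))
    {e : ℕ} (hpow : ∀ ρ : Field.absoluteGaloisGroup K, ρ ^ e ∈ torsionFixing B p)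
    (he : ∀ P : geomTorsion A p, e • P = P)
    {r : ℕ} (xs : Fin r → galH1Torsion A p)
    (hind : ∀ a b : Fin r → ℤ, ∑ i, (a i • xs i + b i • wH (xs i)) = 0 →
      ∀ i, (p : ℤ) ∣ a i ∧ (p : ℤ) ∣ b i)
    (v : Fin r → geomTorsion A p) :
    ∃ ρ ∈ torsionFixing A p ⊓ torsionFixing B p, ∀ i, h1Eval A p (xs i) ρ = v i := by
  -- the `Γ_K`-stable subgroup of joint values over the intersection
  let J : AddSubgroup (Fin r → geomTorsion A p) :=
    { carrier := {m | ∃ ρ ∈ torsionFixing A p ⊓ torsionFixing B p, ∀ i, h1Eval A p (xs i) ρ = m i}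
      zero_mem' := ⟨1, one_mem _, fun i ↦ h1Eval_one A p (xs i)⟩
      add_mem' := by
        rintro m m' ⟨ρ, hρ, hm⟩ ⟨ρ', hρ', hm'⟩
        exact ⟨ρ * ρ', mul_mem hρ hρ', fun i ↦ by
          rw [h1Eval_mul A p (xs i) hρ.1, hm, hm', Pi.add_apply]⟩
      neg_mem' := by
        rintro m ⟨ρ, hρ, hm⟩
        exact ⟨ρ⁻¹, inv_mem hρ, fun i ↦ by rw [h1Eval_inv A p (xs i) hρ.1, hm, Pi.neg_apply]⟩ }
  have hJstab : ∀ g : Field.absoluteGaloisGroup K, ∀ m ∈ J, g • m ∈ J := by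
    rintro g m ⟨ρ, hρ, hm⟩
    refine ⟨g * ρ * g⁻¹, ⟨(torsionFixing_normal A p).conj_mem ρ hρ.1 g,
      (torsionFixing_normal B p).conj_mem ρ hρ.2 g⟩, fun i ↦ ?_⟩
    rw [h1Eval_conj A p (xs i) g hρ.1, hm, Pi.smul_apply]
  have htop := KolyvaginPairing.eq_top_of_stable_of_indep_of_comm hp w hS hC r J hJstab
    (fun a b hab i ↦ ?_)
  · have : v ∈ J := by rw [htop]; trivial
    exact this
  · -- a relation on `J` gives a class vanishing on the intersection, hence everywhere
    refine hind a b (eq_zero_of_h1Eval_eq_zero_of_comm A p hcomm ι hι hιg fun ρ hρ ↦ ?_) i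
    set s := ∑ i, (a i • xs i + b i • wH (xs i)) with hs
    have hvan : ∀ ρ' ∈ torsionFixing A p ⊓ torsionFixing B p, h1Eval A p s ρ' = 0 := by
      intro ρ' hρ'
      rw [hs, h1Eval_sum A p _ _ hρ'.1]
      simp only [h1Eval_add A p _ _ hρ'.1, h1Eval_zsmul A p _ _ hρ'.1, hwH _ _ hρ'.1]
      exact hab _ ⟨ρ', hρ', fun i ↦ rfl⟩
    have h1 : h1Eval A p s (ρ ^ e) = 0 :=
      hvan _ ⟨Subgroup.pow_mem _ hρ e, hpow ρ⟩
    rw [h1Eval_pow_of_mem A p s hρ, he] at h1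
    exact h1

/-- **Prescribed `A`-values with zero `B`-values (disjointness via a commutator).** Under the
hypotheses of `exists_h1Eval_eq_of_comm_of_pow_mem` and given `zA ∈ Γ_{K(B[p])}` with
`zA - 1` surjective on `A[p]` (an element fixing `B[p]` and moving every non-zero point of
`A[p]` — for the HSY pair: `Gal(K(A[2])K(B[2])/K) ≅ μ₃ × μ₃` since `K(A[2]) ≠ K(B[2])`), for every
target `(e_i) ∈ A[p]^r` and every family `(y_j)` of classes of `B` there is
`c ∈ Γ_{K(A[p])} ∩ Γ_{K(B[p])}` with `[x_i, c]_A = e_i` and `[y_j, c]_B = 0`: take `ρ` in the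
intersection with `[x_i, ρ] = P_i`, `zA • P_i - P_i = e_i`, and `c := zA ρ zA⁻¹ ρ⁻¹` — then
`[x, c]_A = zA•[x, ρ] - [x, ρ]` and `[y, c]_B = zA•[y, ρ] - [y, ρ] = 0` (tree `h1Eval_conj`,
`h1Eval_inv`). [cite: GrossLMS1991, §9 (pairing after Prop. 9.1)] -/
theorem exists_h1Eval_eq_and_eq_zero_of_comm (hp : p.Prime)
    (hS : ∀ H : AddSubgroup (geomTorsion A p),
      (∀ g : Field.absoluteGaloisGroup K, ∀ t ∈ H, g • t ∈ H) → H = ⊥ ∨ H = ⊤)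
    (w : geomTorsion A p →+ geomTorsion A p)
    (hC : ∀ f : geomTorsion A p →+ geomTorsion A p,
      (∀ (g : Field.absoluteGaloisGroup K) (t : geomTorsion A p), f (g • t) = g • f t) →
        ∃ a b : ℤ, ∀ t, f t = a • t + b • w t)
    (hcomm : ∀ (g h : Field.absoluteGaloisGroup K) (P : geomTorsion A p), g • h • P = h • g • P)
    {z : Field.absoluteGaloisGroup K} (ι : geomTorsion A p →+ geomTorsion A p)
    (hι : ∀ P, ι (z • P - P) = P)
    (hιg : ∀ (g : Field.absoluteGaloisGroup K) (P : geomTorsion A p), ι (g • P) = g • ι P)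
    (wH : galH1Torsion A p →+ galH1Torsion A p)
    (hwH : ∀ x, ∀ ρ ∈ torsionFixing A p, h1Eval A p (wH x) ρ = w (h1Eval A p x ρ))
    {e : ℕ} (hpow : ∀ ρ : Field.absoluteGaloisGroup K, ρ ^ e ∈ torsionFixing B p)
    (he : ∀ P : geomTorsion A p, e • P = P)
    {zA : Field.absoluteGaloisGroup K} (hzA : zA ∈ torsionFixing B p)
    (hzAsurj : ∀ Q : geomTorsion A p, ∃ P : geomTorsion A p, zA • P - P = Q)
    {r : ℕ} (xs : Fin r → galH1Torsion A p)
    (hind : ∀ a b : Fin r → ℤ, ∑ i, (a i • xs i + b i • wH (xs i)) = 0 →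
      ∀ i, (p : ℤ) ∣ a i ∧ (p : ℤ) ∣ b i)
    (v : Fin r → geomTorsion A p) {ι' : Type*} (ys : ι' → galH1Torsion B p) :
    ∃ c ∈ torsionFixing A p ⊓ torsionFixing B p,
      (∀ i, h1Eval A p (xs i) c = v i) ∧ (∀ j, h1Eval B p (ys j) c = 0) := by
  choose P hP using hzAsurj
  obtain ⟨ρ, hρ, hρv⟩ := exists_h1Eval_eq_of_comm_of_pow_mem A B hp hS w hC hcomm ι hι hιg wH hwH
    hpow he xs hind (fun i ↦ P (v i))
  refine ⟨zA * ρ * zA⁻¹ * ρ⁻¹, ?_, fun i ↦ ?_, fun j ↦ ?_⟩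
  · exact mul_mem ⟨(torsionFixing_normal A p).conj_mem ρ hρ.1 zA,
      (torsionFixing_normal B p).conj_mem ρ hρ.2 zA⟩ (inv_mem hρ)
  · rw [h1Eval_mul A p _ ((torsionFixing_normal A p).conj_mem ρ hρ.1 zA), h1Eval_conj A p _ zA hρ.1,
      h1Eval_inv A p _ hρ.1, hρv i, ← sub_eq_add_neg, hP]
  · rw [h1Eval_mul B p _ ((torsionFixing_normal B p).conj_mem ρ hρ.2 zA), h1Eval_conj B p _ zA hρ.2,
      h1Eval_inv B p _ hρ.2, smul_eq_of_mem_torsionFixing B p hzA, add_neg_cancel]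

/-- **THE JOINT GALOIS ELEMENT for a pair of curves (memo two §57.4, Steps 7 and 8 (b):
simultaneous Čebotarev conditions on `A` and on `B`).** Under the hypotheses of
`exists_h1Eval_eq_and_eq_zero_of_comm` for `A` relative to `B` AND for `B` relative to `A`, for
`(ℤ/p)[w]`-independent families `x_i` (classes of `A`) and `y_j` (classes of `B`) and ANY targets
`(e^A_i) ∈ A[p]^r`, `(e^B_j) ∈ B[p]^{r′}` there is ONE `ρ ∈ Γ_{K(A[p])} ∩ Γ_{K(B[p])}` with
`[x_i, ρ]_A = e^A_i` and `[y_j, ρ]_B = e^B_j` (the product of the two one-sided elements). This is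
the input `ρ` of the pair form of the tree's `exists_kolyvaginPrime_gt_of_galoisElement`; with
`HeegnerPointsKolyvaginPairingCMConj` the values of `(τρm)²` follow. [cite: McCallumLMS1991, §3 (2)] -/
theorem exists_h1Eval_eq_pair_of_comm (hp : p.Prime)
    (hSA : ∀ H : AddSubgroup (geomTorsion A p),
      (∀ g : Field.absoluteGaloisGroup K, ∀ t ∈ H, g • t ∈ H) → H = ⊥ ∨ H = ⊤)
    (wA : geomTorsion A p →+ geomTorsion A p)
    (hCA : ∀ f : geomTorsion A p →+ geomTorsion A p,
      (∀ (g : Field.absoluteGaloisGroup K) (t : geomTorsion A p), f (g • t) = g • f t) →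
        ∃ a b : ℤ, ∀ t, f t = a • t + b • wA t)
    (hcommA : ∀ (g h : Field.absoluteGaloisGroup K) (P : geomTorsion A p), g • h • P = h • g • P)
    {zA₀ : Field.absoluteGaloisGroup K} (ιA : geomTorsion A p →+ geomTorsion A p)
    (hιA : ∀ P, ιA (zA₀ • P - P) = P)
    (hιAg : ∀ (g : Field.absoluteGaloisGroup K) (P : geomTorsion A p), ιA (g • P) = g • ιA P)
    (wHA : galH1Torsion A p →+ galH1Torsion A p)
    (hwHA : ∀ x, ∀ ρ ∈ torsionFixing A p, h1Eval A p (wHA x) ρ = wA (h1Eval A p x ρ))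
    {eA : ℕ} (hpowA : ∀ ρ : Field.absoluteGaloisGroup K, ρ ^ eA ∈ torsionFixing B p)
    (heA : ∀ P : geomTorsion A p, eA • P = P)
    {zA : Field.absoluteGaloisGroup K} (hzA : zA ∈ torsionFixing B p)
    (hzAsurj : ∀ Q : geomTorsion A p, ∃ P : geomTorsion A p, zA • P - P = Q)
    (hSB : ∀ H : AddSubgroup (geomTorsion B p),
      (∀ g : Field.absoluteGaloisGroup K, ∀ t ∈ H, g • t ∈ H) → H = ⊥ ∨ H = ⊤)
    (wB : geomTorsion B p →+ geomTorsion B p)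
    (hCB : ∀ f : geomTorsion B p →+ geomTorsion B p,
      (∀ (g : Field.absoluteGaloisGroup K) (t : geomTorsion B p), f (g • t) = g • f t) →
        ∃ a b : ℤ, ∀ t, f t = a • t + b • wB t)
    (hcommB : ∀ (g h : Field.absoluteGaloisGroup K) (P : geomTorsion B p), g • h • P = h • g • P)
    {zB₀ : Field.absoluteGaloisGroup K} (ιB : geomTorsion B p →+ geomTorsion B p)
    (hιB : ∀ P, ιB (zB₀ • P - P) = P)
    (hιBg : ∀ (g : Field.absoluteGaloisGroup K) (P : geomTorsion B p), ιB (g • P) = g • ιB P)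
    (wHB : galH1Torsion B p →+ galH1Torsion B p)
    (hwHB : ∀ x, ∀ ρ ∈ torsionFixing B p, h1Eval B p (wHB x) ρ = wB (h1Eval B p x ρ))
    {eB : ℕ} (hpowB : ∀ ρ : Field.absoluteGaloisGroup K, ρ ^ eB ∈ torsionFixing A p)
    (heB : ∀ P : geomTorsion B p, eB • P = P)
    {zB : Field.absoluteGaloisGroup K} (hzB : zB ∈ torsionFixing A p)
    (hzBsurj : ∀ Q : geomTorsion B p, ∃ P : geomTorsion B p, zB • P - P = Q)
    {r : ℕ} (xs : Fin r → galH1Torsion A p)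
    (hindA : ∀ a b : Fin r → ℤ, ∑ i, (a i • xs i + b i • wHA (xs i)) = 0 →
      ∀ i, (p : ℤ) ∣ a i ∧ (p : ℤ) ∣ b i)
    {r' : ℕ} (ys : Fin r' → galH1Torsion B p)
    (hindB : ∀ a b : Fin r' → ℤ, ∑ j, (a j • ys j + b j • wHB (ys j)) = 0 →
      ∀ j, (p : ℤ) ∣ a j ∧ (p : ℤ) ∣ b j)
    (vA : Fin r → geomTorsion A p) (vB : Fin r' → geomTorsion B p) :
    ∃ ρ ∈ torsionFixing A p ⊓ torsionFixing B p,
      (∀ i, h1Eval A p (xs i) ρ = vA i) ∧ (∀ j, h1Eval B p (ys j) ρ = vB j) := by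
  obtain ⟨cA, hcA, hcAx, hcAy⟩ := exists_h1Eval_eq_and_eq_zero_of_comm A B hp hSA wA hCA hcommA ιA
    hιA hιAg wHA hwHA hpowA heA hzA hzAsurj xs hindA vA ys
  obtain ⟨cB, hcB, hcBy, hcBx⟩ := exists_h1Eval_eq_and_eq_zero_of_comm B A hp hSB wB hCB hcommB ιB
    hιB hιBg wHB hwHB hpowB heB hzB hzBsurj ys hindB vB xs
  refine ⟨cA * cB, mul_mem hcA ⟨hcB.2, hcB.1⟩, fun i ↦ ?_, fun j ↦ ?_⟩
  · rw [h1Eval_mul A p _ hcA.1, hcAx, hcBx, add_zero]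
  · rw [h1Eval_mul B p _ hcA.2, hcAy, hcBy, zero_add]

end Pair

end Literature.NumberTheory.EllipticCurves

end
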